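import Summits.ValiantsHypothesis.ValiantsHypothesis.Theorems.BarrierLeverDefinableEquationsIsobaric
import Literature.Computability.AlgebraicComplexity.DeterminantalComplexityProofs

/-!
# Cruxes `BarrierLever.DefinableEquations` (stmt-ValiantsHypothesis-8745) and
# `DefinableDcEquations` (8746) — the isobaric normal form for ANY torus-stable slice, and for the
# determinantal slice `{deg ≤ n, dc ≤ m(n)}` of crux 8746

The extraction of `…DefinableEquationsIsobaric.lean` only uses that the simple class is mapped into
(a slightly larger) simple class by the torus translates `f ↦ t^{u₀} f(t^{u_1} x_1, …, t^{u_n} x_n)`.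
This file records the GENERAL form and instantiates it for crux 8746:

* `isoEq_of_eq_of_stable` — for classes `P ⊆ P'` of `n`-variate polynomials with every torus
  translate of a member of `P` in `P'` (`n ≥ 64`, `n ≥ 2a + 6`): a nonzero level-`a` Boolean-sum
  equation for `coeff(P')` yields a nonzero level-`(a+3)` Boolean-sum equation for `coeff(P)` that is
  a torus WEIGHT VECTOR (homogeneous of some degree `d`, isobaric of some weight `w_i` for every
  coordinate grading `c_m ↦ m_i`), whose support lies in the support of the given equation.
* `hasDetRepr_torusTranslate`, `determinantalComplexity_torusTranslate_le` — determinantal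
  complexity is invariant under torus translates (scale the variables inside an affine
  determinantal representation and one row by `t^{u₀}`): `dc(t^{u₀} f(t^u x)) ≤ max (dc f) 1`; so
  the dc-slice `{f : deg f ≤ n, dc f ≤ M}` (`M ≥ 1`) is torus-stable ON THE NOSE
  (`dcSlice_torusStable`).
* `definableDcEquations_iff_isobaric` — crux 8746 holds iff it holds with witnesses whose Boolean
  sum is a torus weight vector (same threshold function `m`, level `a ↦ a + 3`).  This is the
  natural home of the route's intended witnesses for 8746 (slice restrictions of weight vectors of
  `GL_{m²}`-modules are `T_n`-weight vectors).

Pure bookkeeping; no definitions, no named facts.  HONEST FRAMING: normal forms only; the open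
content of 8745/8746 (Chatterjee–Tengse 2023 §1.3 dir. 2; the threshold of 8746) is untouched.
References: [MignonRessayre2004] §1 (dc); [Burgisser2000] §2.5; [ForbesShpilkaVolk2018] Def. 1.
-/

-- layout Summits/ValiantsHypothesis/ValiantsHypothesis forces the duplicated namespace component
set_option linter.dupNamespace false

noncomputable section

open MvPolynomial

namespace Summit.ValiantsHypothesis.ValiantsHypothesis.Theorems.BarrierLever.IsobaricEquations

open Literature.Computability.AlgebraicComplexity Literature.Barriers.ValiantsHypothesis
open Summit.ValiantsHypothesis.ValiantsHypothesis.Theorems.BarrierLever.SuccinctHittingSetsForVP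
open Summit.ValiantsHypothesis.ValiantsHypothesis.Theorems.BarrierLever.BoolSumComponents

variable {n : ℕ}

/-! ## §1 The extraction for an arbitrary torus-stable pair of classes -/

/-- **Isobaric components of an equation for `P'` are equations for `P`** when every torus
translate of a member of `P` lies in `P'`. [folklore] -/
theorem eval_component_eq_zero_of_stable {P P' : Set (MvPolynomial (Fin n) ℂ)}
    (hstab : ∀ f ∈ P, ∀ (t : ℂ) (u₀ : ℕ) (u : Fin n → ℕ),
      C (t ^ u₀) * aeval (fun i => C (t ^ u i) * X i) f ∈ P')
    {E : MvPolynomial (degLEMonomials n) ℂ}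
    (hE : ∀ f ∈ P', eval (coeffVector (degLEMonomials n) f) E = 0)
    (u₀ : ℕ) (u : Fin n → ℕ) (J : ℕ) {f : MvPolynomial (Fin n) ℂ} (hf : f ∈ P) :
    eval (coeffVector (degLEMonomials n) f)
      (weightedHomogeneousComponent
        (fun m : degLEMonomials n => u₀ + ∑ i, u i * (m : Fin n →₀ ℕ) i) J E) = 0 := by
  refine Isobaric.eval_weightedHomogeneousComponent_eq_zero (fun t => ?_) J
  have hpt : (fun m : degLEMonomials n =>
        t ^ (u₀ + ∑ i, u i * (m : Fin n →₀ ℕ) i) * coeffVector (degLEMonomials n) f m) =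
      coeffVector (degLEMonomials n) (C (t ^ u₀) * aeval (fun i => C (t ^ u i) * X i) f) := by
    funext m
    rw [coeffVector_apply, coeffVector_apply, coeff_torusTranslate]
  rw [hpt]
  exact hE _ (hstab f hf t u₀ u)

/-- **The isobaric extraction for a torus-stable pair `P ⊆ P'`** (`n ≥ 64`, `n ≥ 2a + 6`): from a
nonzero level-`a` Boolean-sum equation for `coeff(P')` to a nonzero level-`(a+3)` Boolean-sum
equation for `coeff(P)` that is a torus weight vector, supported inside the given support.
[folklore] -/
theorem isoEq_of_eq_of_stable {a : ℕ} (hn : 64 ≤ n) (ha : 2 * a + 6 ≤ n)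
    {P P' : Set (MvPolynomial (Fin n) ℂ)}
    (hstab : ∀ f ∈ P, ∀ (t : ℂ) (u₀ : ℕ) (u : Fin n → ℕ),
      C (t ^ u₀) * aeval (fun i => C (t ^ u i) * X i) f ∈ P')
    {q : ℕ} (hq : q ≤ (Nat.choose (2 * n) n) ^ a) (H : MvPolynomial (↥(degLEMonomials n) ⊕ Fin q) ℂ)
    (hc : complexity H ≤ (Nat.choose (2 * n) n) ^ a) (hd : H.totalDegree ≤ (Nat.choose (2 * n) n) ^ a)
    (hne : boolSum H ≠ 0)
    (hvan : ∀ f ∈ P', eval (coeffVector (degLEMonomials n) f) (boolSum H) = 0) :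
    ∃ q' : ℕ, q' ≤ (Nat.choose (2 * n) n) ^ (a + 3) ∧
      ∃ H' : MvPolynomial (↥(degLEMonomials n) ⊕ Fin q') ℂ,
        complexity H' ≤ (Nat.choose (2 * n) n) ^ (a + 3) ∧
        H'.totalDegree ≤ (Nat.choose (2 * n) n) ^ (a + 3) ∧ boolSum H' ≠ 0 ∧
        (∀ f ∈ P, eval (coeffVector (degLEMonomials n) f) (boolSum H') = 0) ∧
        (boolSum H').support ⊆ (boolSum H).support ∧
        ∃ (d : ℕ) (w : Fin n → ℕ), (boolSum H').IsHomogeneous d ∧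
          ∀ i : Fin n, IsWeightedHomogeneous
            (fun m : degLEMonomials n => (m : Fin n →₀ ℕ) i) (boolSum H') (w i) := by
  classical
  haveI : Fintype (degLEMonomials n) := (Finsupp.finite_of_degree_le (σ := Fin n) n).fintype
  obtain ⟨h5, hnN, -, -⟩ := N_arith hn
  set N := (2 * n).choose n with hNdef
  set E := boolSum H with hEdef
  set B := n * N ^ a + 1 with hBdef
  set W : degLEMonomials n → ℕ := fun m => B ^ n + ∑ i : Fin n, B ^ (i : ℕ) * (m : Fin n →₀ ℕ) i
    with hWdef
  have hB : 0 < B := Nat.succ_pos _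
  have hdegE : E.totalDegree ≤ N ^ a := (totalDegree_boolSum_le H).trans hd
  have hWmax : ∀ m : degLEMonomials n, W m ≤ (n + 1) * B ^ n := by
    intro m
    have hB1 : 1 ≤ B := hB
    have hsum : ∑ i : Fin n, B ^ (i : ℕ) * (m : Fin n →₀ ℕ) i ≤ B ^ n * n := by
      calc ∑ i : Fin n, B ^ (i : ℕ) * (m : Fin n →₀ ℕ) i
          ≤ ∑ i : Fin n, B ^ n * (m : Fin n →₀ ℕ) i := Finset.sum_le_sum fun i _ =>
            Nat.mul_le_mul_right _ (Nat.pow_le_pow_right hB1 i.2.le)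
        _ = B ^ n * ∑ i : Fin n, (m : Fin n →₀ ℕ) i := by rw [Finset.mul_sum]
        _ ≤ B ^ n * n := Nat.mul_le_mul_left _ ?_
      calc ∑ i : Fin n, (m : Fin n →₀ ℕ) i = (m : Fin n →₀ ℕ).degree := by
            rw [Finsupp.degree_apply]
            exact (Finset.sum_subset (Finset.subset_univ _) fun i _ hi =>
              Finsupp.notMem_support_iff.mp hi).symm
        _ ≤ n := m.2
    calc W m = B ^ n + ∑ i : Fin n, B ^ (i : ℕ) * (m : Fin n →₀ ℕ) i := rfl
      _ ≤ B ^ n + B ^ n * n := Nat.add_le_add_left hsum _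
      _ = (n + 1) * B ^ n := by ring
  have hK : weightedTotalDegree W E < 2 ^ N := by
    calc weightedTotalDegree W E ≤ E.totalDegree * ((n + 1) * B ^ n) :=
          weightedTotalDegree_le W _ hWmax E
      _ ≤ N ^ a * ((n + 1) * B ^ n) := Nat.mul_le_mul_right _ hdegE
      _ < 2 ^ N := wdeg_arith hn ha
  obtain ⟨J, hJmem, hJne⟩ : ∃ J ∈ Finset.range (weightedTotalDegree W E + 1),
      weightedHomogeneousComponent W J E ≠ 0 := by
    by_contra hall
    push Not at hall
    apply hne
    rw [hEdef, ← Isobaric.sum_weightedHomogeneousComponent_range W (boolSum H)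
      (weightedTotalDegree W E) (fun d hd => le_weightedTotalDegree W hd)]
    exact Finset.sum_eq_zero hall
  have hJ : J < 2 ^ N := lt_of_le_of_lt (Nat.lt_succ_iff.mp (Finset.mem_range.mp hJmem)) hK
  obtain ⟨H', hsum', hc', hd'⟩ :=
    exists_boolSum_eq_weightedHomogeneousComponent W H (L := N) (J := J) hK hJ
  obtain ⟨lq, lc, ld⟩ := level_arith (a := a) (q := q) (c := complexity H) (d := H.totalDegree)
    h5 hq hc hd
  have hsupp : (weightedHomogeneousComponent W J E).support ⊆ E.support := by
    intro α hα
    rw [mem_support_iff, coeff_weightedHomogeneousComponent] at hα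
    rw [mem_support_iff]
    intro h0; exact hα (by rw [h0, ite_self])
  refine ⟨q + N, lq, H', ?_, hd'.trans ld, ?_, ?_, ?_, ?_⟩
  · refine hc'.trans ?_
    rw [card_degLEMonomials]
    exact lc
  · rw [hsum']; exact hJne
  · intro f hf
    rw [hsum']
    exact eval_component_eq_zero_of_stable hstab hvan (B ^ n) (fun i => B ^ (i : ℕ)) J hf
  · rw [hsum']; exact hsupp
  · rw [hsum']
    refine weightVector_of_combined hB (weightedHomogeneousComponent_isWeightedHomogeneous J E)
      (fun α hα => ?_) hJne
    have hdegα : α.degree ≤ N ^ a := by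
      rw [Finsupp.degree_apply]
      exact (le_totalDegree (hsupp hα)).trans hdegE
    constructor
    · calc n * α.degree ≤ n * N ^ a := Nat.mul_le_mul_left _ hdegα
        _ < B := Nat.lt_succ_self _
    · calc α.degree ≤ N ^ a := hdegα
        _ ≤ n * N ^ a := Nat.le_mul_of_pos_left _ (by omega)
        _ < B := Nat.lt_succ_self _

/-! ## §2 Determinantal complexity is invariant under torus translates -/

/-- **An affine determinantal representation of `f` of size `m ≥ 1` yields one of
`t^{u₀} f(t^{u_1} x_1, …, t^{u_n} x_n)` of the same size**: substitute `x_i ↦ t^{u_i} x_i` in the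
entries (still affine) and multiply the first row by `t^{u₀}`. [cite: MignonRessayre2004, §1] -/
theorem hasDetRepr_torusTranslate {f : MvPolynomial (Fin n) ℂ} {m : ℕ} (h : HasDetRepr f m)
    (hm : 1 ≤ m) (t : ℂ) (u₀ : ℕ) (u : Fin n → ℕ) :
    HasDetRepr (C (t ^ u₀) * aeval (fun i => C (t ^ u i) * X i) f) m := by
  classical
  obtain ⟨A, hA1, hAdet⟩ := h
  set φ : MvPolynomial (Fin n) ℂ →ₐ[ℂ] MvPolynomial (Fin n) ℂ :=
    aeval (fun i => C (t ^ u i) * X i) with hφ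
  have hφ1 : ∀ i, ((fun i => (C (t ^ u i) * X i : MvPolynomial (Fin n) ℂ)) i).totalDegree ≤ 1 :=
    fun i => by
      refine (totalDegree_mul _ _).trans ?_
      rw [totalDegree_C, totalDegree_X, zero_add]
  set A' : Matrix (Fin m) (Fin m) (MvPolynomial (Fin n) ℂ) := φ.mapMatrix A with hA'
  have hA'1 : ∀ i j, (A' i j).totalDegree ≤ 1 := fun i j => by
    rw [hA', AlgHom.mapMatrix_apply, Matrix.map_apply]
    exact (HasDetRepr.totalDegree_aeval_le_of_le_one _ hφ1 _).trans (hA1 i j)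
  have hA'det : A'.det = φ f := by rw [hA', ← AlgHom.map_det, hAdet]
  let i₀ : Fin m := ⟨0, hm⟩
  refine ⟨A'.updateRow i₀ ((C (t ^ u₀) : MvPolynomial (Fin n) ℂ) • A' i₀), fun i j => ?_, ?_⟩
  · rw [Matrix.updateRow_apply]
    split_ifs
    · rw [Pi.smul_apply, smul_eq_mul]
      refine (totalDegree_mul _ _).trans ?_
      rw [totalDegree_C, zero_add]
      exact hA'1 _ _
    · exact hA'1 i j
  · rw [Matrix.det_updateRow_smul, Matrix.updateRow_eq_self, hA'det]

/-- **`dc(t^{u₀} f(t^u x)) ≤ max (dc f) 1`.** [cite: MignonRessayre2004, §1] -/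
theorem determinantalComplexity_torusTranslate_le (f : MvPolynomial (Fin n) ℂ) (t : ℂ) (u₀ : ℕ)
    (u : Fin n → ℕ) :
    determinantalComplexity (C (t ^ u₀) * aeval (fun i => C (t ^ u i) * X i) f) ≤
      max (determinantalComplexity f) 1 := by
  have h := hasDetRepr_determinantalComplexity_holds (k := ℂ) (σ := Fin n) f
  have h' : HasDetRepr f (max (determinantalComplexity f) 1) :=
    HasDetRepr.mono_holds h (le_max_left _ _)
  exact determinantalComplexity_le_of_hasDetRepr
    (hasDetRepr_torusTranslate h' (le_max_right _ _) t u₀ u)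

/-- **The determinantal slice `{deg ≤ n, dc ≤ M}` is torus-stable** for `M ≥ 1`. [folklore] -/
theorem dcSlice_torusStable {M : ℕ} (hM : 1 ≤ M) :
    ∀ f ∈ {f : MvPolynomial (Fin n) ℂ | f.totalDegree ≤ n ∧ determinantalComplexity f ≤ M},
      ∀ (t : ℂ) (u₀ : ℕ) (u : Fin n → ℕ),
        C (t ^ u₀) * aeval (fun i => C (t ^ u i) * X i) f ∈
          {f : MvPolynomial (Fin n) ℂ | f.totalDegree ≤ n ∧ determinantalComplexity f ≤ M} := by
  rintro f ⟨hdeg, hdc⟩ t u₀ u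
  refine ⟨?_, (determinantalComplexity_torusTranslate_le f t u₀ u).trans (max_le hdc hM)⟩
  refine (totalDegree_mul _ _).trans ?_
  rw [totalDegree_C, zero_add]
  refine (HasDetRepr.totalDegree_aeval_le_of_le_one _ (fun i => ?_) f).trans hdeg
  refine (totalDegree_mul _ _).trans ?_
  rw [totalDegree_C, totalDegree_X, zero_add]

/-! ## §3 Crux 8746 in isobaric normal form -/

/-- **`DefinableDcEquations` in isobaric normal form** (crux stmt-ValiantsHypothesis-8746): the crux
holds iff it holds with witnesses whose Boolean sum is a torus weight vector — homogeneous of some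
degree `d` and isobaric of some weight `w_i` for every coordinate grading `c_m ↦ m_i` (same
threshold function `m`; level `a ↦ a + 3`; no loss in the slice, which is torus-stable on the
nose). [cite: ForbesShpilkaVolk2018, Def. 1] -/
theorem definableDcEquations_iff_isobaric :
    Summit.ValiantsHypothesis.ValiantsHypothesis.Theses.BarrierLever.DefinableDcEquations ↔
      ∃ m : ℕ → ℕ, (∀ C : ℕ, ∃ n₀ : ℕ, ∀ n ≥ n₀, 2 ^ (C * (Nat.log 2 n + 1) ^ 2) ≤ m n) ∧
        ∃ a n₀ : ℕ, ∀ n ≥ n₀, ∃ q : ℕ, q ≤ (Nat.choose (2 * n) n) ^ a ∧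
          ∃ H : MvPolynomial (↥(degLEMonomials n) ⊕ Fin q) ℂ,
            complexity H ≤ (Nat.choose (2 * n) n) ^ a ∧ H.totalDegree ≤ (Nat.choose (2 * n) n) ^ a ∧
            boolSum H ≠ 0 ∧
            (∀ f : MvPolynomial (Fin n) ℂ, f.totalDegree ≤ n → determinantalComplexity f ≤ m n →
              eval (coeffVector (degLEMonomials n) f) (boolSum H) = 0) ∧
            ∃ (d : ℕ) (w : Fin n → ℕ), (boolSum H).IsHomogeneous d ∧
              ∀ i : Fin n, IsWeightedHomogeneous
                (fun m : degLEMonomials n => (m : Fin n →₀ ℕ) i) (boolSum H) (w i) := by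
  constructor
  · rintro ⟨m, hgrow, a, n₀, h⟩
    refine ⟨m, hgrow, a + 3, ?_⟩
    obtain ⟨n₁, hn₁⟩ := hgrow 0
    refine ⟨max n₀ (max n₁ (max 64 (2 * a + 6))), fun n hn => ?_⟩
    have hA := le_max_left n₀ (max n₁ (max 64 (2 * a + 6)))
    have hB := le_max_right n₀ (max n₁ (max 64 (2 * a + 6)))
    have hC := le_max_left n₁ (max 64 (2 * a + 6))
    have hD := le_max_right n₁ (max 64 (2 * a + 6))
    have hE := le_max_left 64 (2 * a + 6)
    have hF := le_max_right 64 (2 * a + 6)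
    obtain ⟨q, hq, H, hc, hd, hne, hvan⟩ := h n (by omega)
    have hM : 1 ≤ m n := by
      have := hn₁ n (by omega)
      simpa using this
    set P : Set (MvPolynomial (Fin n) ℂ) :=
      {f | f.totalDegree ≤ n ∧ determinantalComplexity f ≤ m n} with hP
    have hvanP : ∀ f ∈ P, eval (coeffVector (degLEMonomials n) f) (boolSum H) = 0 :=
      fun f hf => hvan f hf.1 hf.2
    obtain ⟨q', hq', H', hc', hd', hne', hvan', -, d, w, hhom, hiso⟩ :=
      isoEq_of_eq_of_stable (a := a) (by omega) (by omega) (dcSlice_torusStable hM)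
        hq H hc hd hne hvanP
    exact ⟨q', hq', H', hc', hd', hne', fun f h1 h2 => hvan' f ⟨h1, h2⟩, d, w, hhom, hiso⟩
  · rintro ⟨m, hgrow, a, n₀, h⟩
    refine ⟨m, hgrow, a, n₀, fun n hn => ?_⟩
    obtain ⟨q, hq, H, hc, hd, hne, hvan, -⟩ := h n hn
    exact ⟨q, hq, H, hc, hd, hne, hvan⟩

end Summit.ValiantsHypothesis.ValiantsHypothesis.Theorems.BarrierLever.IsobaricEquations

end
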